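import Summits.AnomalousDissipation.AnomalousDissipation.Theorems.SolenoidalFractalHomogenisationRealisedQuasiStaticCellLawPrincipalCosetEnergy
import HarnessLib

/-!
# K2R `RealisedQuasiStaticCellLaw`, line `floquet-bloch`: the Leray cosines of the in-plane block are at most one in modulus
# (hypothesis `hs` of `inPlane_block_decay`; helper towards `stub_lowSectorDecay`; `--supports stmt-AnomalousDissipation-20446`)

Summits-side helper file (everything proved; no definitions, no named facts). The in-plane direction
`p(k) = (√(k·k))⁻¹ • k × ζ` of an integer frequency `k` (with `ζ` a real unit vector normal to `k`) has `p·p ≤ 1` — it is a unit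
vector for `k ≠ 0` (`inPlane_dot_self`) and `0` for `k = 0` — so by Cauchy–Schwarz (Lagrange's identity) any two such directions
have `|p(k)·p(k')| ≤ 1` (`abs_inPlane_link_le_one`): recipe H5 of the S1D far-sector assembly.
-/

set_option linter.dupNamespace false

noncomputable section

namespace Summit.AnomalousDissipation.AnomalousDissipation.Theorems.SolenoidalFractalHomogenisation.RealisedQuasiStaticCellLaw

open Matrix
open scoped Matrix

/-- `p(k)·p(k) ≤ 1` for the in-plane direction of any integer frequency `k` normal to the unit vector `ζ`. -/
theorem inPlane_dot_self_le_one (k : Fin 3 → ℤ) {ζr : Fin 3 → ℝ} (hζ1 : ζr ⬝ᵥ ζr = 1)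
    (hζk : ζr ⬝ᵥ (fun i => ((k i : ℤ) : ℝ)) = 0) :
    ((Real.sqrt ((fun i => ((k i : ℤ) : ℝ)) ⬝ᵥ (fun i => ((k i : ℤ) : ℝ))))⁻¹ • (fun i => ((k i : ℤ) : ℝ)) ⨯₃ ζr) ⬝ᵥ
      ((Real.sqrt ((fun i => ((k i : ℤ) : ℝ)) ⬝ᵥ (fun i => ((k i : ℤ) : ℝ))))⁻¹ • (fun i => ((k i : ℤ) : ℝ)) ⨯₃ ζr) ≤ 1 := by
  by_cases hk : k = 0
  · subst hk
    have h0 : (fun i => (((0 : Fin 3 → ℤ) i : ℤ) : ℝ)) = 0 := by funext i; simp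
    rw [h0]
    simp
  · rw [inPlane_dot_self hk hζ1 hζk]

/-- **The Leray cosines are at most one**: `|p(k)·p(k')| ≤ 1` for the in-plane directions of two integer frequencies normal
to the unit vector `ζ`. -/
theorem abs_inPlane_link_le_one (k k' : Fin 3 → ℤ) {ζr : Fin 3 → ℝ} (hζ1 : ζr ⬝ᵥ ζr = 1)
    (hζk : ζr ⬝ᵥ (fun i => ((k i : ℤ) : ℝ)) = 0) (hζk' : ζr ⬝ᵥ (fun i => ((k' i : ℤ) : ℝ)) = 0) :
    |((Real.sqrt ((fun i => ((k i : ℤ) : ℝ)) ⬝ᵥ (fun i => ((k i : ℤ) : ℝ))))⁻¹ • (fun i => ((k i : ℤ) : ℝ)) ⨯₃ ζr) ⬝ᵥ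
      ((Real.sqrt ((fun i => ((k' i : ℤ) : ℝ)) ⬝ᵥ (fun i => ((k' i : ℤ) : ℝ))))⁻¹ • (fun i => ((k' i : ℤ) : ℝ)) ⨯₃ ζr)| ≤ 1 := by
  set p := (Real.sqrt ((fun i => ((k i : ℤ) : ℝ)) ⬝ᵥ (fun i => ((k i : ℤ) : ℝ))))⁻¹ • (fun i => ((k i : ℤ) : ℝ)) ⨯₃ ζr
    with hp
  set p' := (Real.sqrt ((fun i => ((k' i : ℤ) : ℝ)) ⬝ᵥ (fun i => ((k' i : ℤ) : ℝ))))⁻¹ • (fun i => ((k' i : ℤ) : ℝ)) ⨯₃ ζr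
    with hp'
  have h1 : p ⬝ᵥ p ≤ 1 := inPlane_dot_self_le_one k hζ1 hζk
  have h2 : p' ⬝ᵥ p' ≤ 1 := inPlane_dot_self_le_one k' hζ1 hζk'
  have hnn : ∀ w : Fin 3 → ℝ, 0 ≤ w ⬝ᵥ w := fun w => by
    have h := dotProduct_star_self_nonneg w
    rwa [star_trivial] at h
  have h1' : 0 ≤ p ⬝ᵥ p := hnn p
  have h2' : 0 ≤ p' ⬝ᵥ p' := hnn p'
  -- Cauchy–Schwarz from Lagrange's identity
  have hcs : (p ⬝ᵥ p') ^ 2 ≤ (p ⬝ᵥ p) * (p' ⬝ᵥ p') := by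
    have h := cross_dot_cross p p' p p'
    have h0 := hnn (p ⨯₃ p')
    rw [h, dotProduct_comm p' p] at h0
    nlinarith
  have hsq : (p ⬝ᵥ p') ^ 2 ≤ 1 := hcs.trans (by nlinarith)
  exact abs_le_one_iff_mul_self_le_one.2 (by nlinarith [hsq])

end Summit.AnomalousDissipation.AnomalousDissipation.Theorems.SolenoidalFractalHomogenisation.RealisedQuasiStaticCellLaw

end
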